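import Summits.ResolutionOfSingularities.KangarooAtlas.MizutaniSpreadTrunc
import Mathlib.RingTheory.MvPolynomial.Ideal
import Mathlib.RingTheory.Ideal.Quotient.Operations
import Mathlib.LinearAlgebra.Quotient.Basic
import HarnessLib

/-!
# Mizutani's conjecture `m(e) = 2p^e − 1` — the truncated polynomial ring `k[u]/(u_i^q)` and its box section

Cell topic `Summits/ResolutionOfSingularities/KangarooAtlas` (pub-rosobs); namespace
`Summit.ResolutionOfSingularities.KangarooAtlas.Mizutani`.  Part of the Lean transcription of the
in-house note MIZUTANI-PROOF-g59 (AI-written, AI-audited; *AI review is weaker than expert review*; not a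
resolution theorem).  Infrastructure for the TOWER files (§1.2/§1.4 of the note: `k ⊗_L k = k[t]/(t_i^q)` and
the Taylor morphism with values in `k[u]/(u_i^q)`):

* `boxIdeal ι k q = (X_i^q : i)` in `MvPolynomial ι k`, membership criterion `mem_boxIdeal_iff`
  (every monomial has some exponent `≥ q`, i.e. lies outside the box);
* `BoxQuot ι k q = MvPolynomial ι k ⧸ boxIdeal ι k q` and its BOX SECTION `truncQ : BoxQuot →ₗ[k] MvPolynomial`
  (`truncQ [f] = trunc q f`), with `mk (truncQ z) = z`, `truncQ` box-supported, multiplicativity up to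
  truncation (`truncQ (z * z') = trunc (truncQ z * truncQ z')`) and compatibility with constants.

References: [Oda1983HironakaGroupSchemeII] §1 (p. 1166); [EGAIV4] Thm. 16.11.2.
-/

open MvPolynomial

namespace Summit.ResolutionOfSingularities.KangarooAtlas.Mizutani

section BoxIdeal

variable (ι : Type*) [Fintype ι] [DecidableEq ι] (k : Type*) [CommRing k] (q : ℕ)

/-- The ideal `(X_i^q : i ∈ ι)` — the relations `t_i^q = 0` of `k ⊗_L k`, resp. `u_i^q = 0` of the truncated
Taylor target. [cite: Oda1983HironakaGroupSchemeII, §1 (p. 1166)] -/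
noncomputable def boxIdeal : Ideal (MvPolynomial ι k) :=
  Ideal.span ((fun s => monomial s (1 : k)) '' Set.range fun i : ι => Finsupp.single i q)

omit [Fintype ι] [DecidableEq ι] in
/-- `X_i^q ∈ boxIdeal`. [folklore] -/
theorem X_pow_mem_boxIdeal (i : ι) : (X i : MvPolynomial ι k) ^ q ∈ boxIdeal ι k q := by
  unfold boxIdeal
  rw [X_pow_eq_monomial]
  exact Ideal.subset_span ⟨Finsupp.single i q, ⟨i, rfl⟩, rfl⟩

omit [Fintype ι] [DecidableEq ι] in
/-- **Membership in the box ideal**: every monomial lies outside the box. [folklore] -/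
theorem mem_boxIdeal_iff {f : MvPolynomial ι k} : f ∈ boxIdeal ι k q ↔ ∀ M ∈ f.support, ¬ InBox q M := by
  unfold boxIdeal
  rw [mem_ideal_span_monomial_image]
  refine forall₂_congr fun M _ => ?_
  constructor
  · rintro ⟨_, ⟨i, rfl⟩, hle⟩ hbox
    have := hbox i
    rw [Finsupp.single_le_iff] at hle
    omega
  · intro h
    unfold InBox at h
    push Not at h
    obtain ⟨i, hi⟩ := h
    exact ⟨Finsupp.single i q, ⟨i, rfl⟩, Finsupp.single_le_iff.mpr hi⟩

omit [Fintype ι] [DecidableEq ι] in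
/-- A box-supported member of the box ideal is zero. [folklore] -/
theorem eq_zero_of_mem_boxIdeal {f : MvPolynomial ι k} (hf : f ∈ boxIdeal ι k q)
    (hbox : ∀ M ∈ f.support, InBox q M) : f = 0 := by
  rw [mem_boxIdeal_iff] at hf
  by_contra hne
  obtain ⟨M, hM⟩ := Finset.nonempty_iff_ne_empty.mpr (fun h => hne (support_eq_empty.mp h))
  exact hf M hM (hbox M hM)

/-- `f − trunc f ∈ boxIdeal` (the monomials outside the box). [folklore] -/
theorem sub_trunc_mem_boxIdeal (f : MvPolynomial ι k) : f - trunc q f ∈ boxIdeal ι k q := by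
  rw [mem_boxIdeal_iff]
  intro M hM hbox
  rw [mem_support_iff, coeff_sub, coeff_trunc, if_pos hbox, sub_self] at hM
  exact hM rfl

/-- `trunc` kills the box ideal. [folklore] -/
theorem trunc_eq_zero_of_mem_boxIdeal {f : MvPolynomial ι k} (hf : f ∈ boxIdeal ι k q) : trunc q f = 0 := by
  rw [mem_boxIdeal_iff] at hf
  refine MvPolynomial.ext _ _ fun M => ?_
  rw [coeff_trunc, coeff_zero]
  split_ifs with hbox
  · by_contra hne
    exact hf M (mem_support_iff.mpr hne) hbox
  · rfl

/-- **The truncated polynomial ring** `k[u_i : i ∈ ι]/(u_i^q)`.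
[cite: EGAIV4, Thm. 16.11.2 (P^n_{A} = truncated Taylor target)] -/
abbrev BoxQuot := MvPolynomial ι k ⧸ boxIdeal ι k q

/-- **The box section** of the quotient: the unique box-supported representative.
[cite: Oda1983HironakaGroupSchemeII, §1 (p. 1166: the monomials in the box form a basis)] -/
noncomputable def truncQ : BoxQuot ι k q →ₗ[k] MvPolynomial ι k :=
  (((boxIdeal ι k q).restrictScalars k).liftQ (trunc q) (by
      intro f hf
      rw [LinearMap.mem_ker]
      exact trunc_eq_zero_of_mem_boxIdeal ι k q hf)).comp
    (Submodule.Quotient.restrictScalarsEquiv k (boxIdeal ι k q)).symm.toLinearMap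

variable {ι k q}

/-- `truncQ [f] = trunc f`. [folklore] -/
@[simp] theorem truncQ_mk (f : MvPolynomial ι k) :
    truncQ ι k q (Ideal.Quotient.mk (boxIdeal ι k q) f) = trunc q f := by
  unfold truncQ
  rw [LinearMap.comp_apply, LinearEquiv.coe_toLinearMap, ← Ideal.Quotient.mk_eq_mk,
    Submodule.Quotient.restrictScalarsEquiv_symm_mk, Submodule.liftQ_apply]

/-- `[truncQ z] = z`. [folklore] -/
theorem mk_truncQ (z : BoxQuot ι k q) : Ideal.Quotient.mk (boxIdeal ι k q) (truncQ ι k q z) = z := by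
  obtain ⟨f, rfl⟩ := Ideal.Quotient.mk_surjective z
  rw [truncQ_mk, Ideal.Quotient.eq]
  have := sub_trunc_mem_boxIdeal ι k q f
  rwa [← neg_sub, Ideal.neg_mem_iff] at this

/-- `truncQ z` is supported in the box. [folklore] -/
theorem inBox_of_mem_support_truncQ (z : BoxQuot ι k q) {M : ι →₀ ℕ} (hM : M ∈ (truncQ ι k q z).support) :
    InBox q M := by
  obtain ⟨f, rfl⟩ := Ideal.Quotient.mk_surjective z
  rw [truncQ_mk] at hM
  exact inBox_of_mem_support_trunc q f hM

/-- `truncQ` is multiplicative up to truncation. [folklore] -/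
theorem truncQ_mul (z z' : BoxQuot ι k q) : truncQ ι k q (z * z') = trunc q (truncQ ι k q z * truncQ ι k q z') := by
  conv_lhs => rw [← mk_truncQ z, ← mk_truncQ z', ← map_mul, truncQ_mk]

/-- `truncQ` on constants `[C c] · z`. [folklore] -/
theorem truncQ_C_mul (c : k) (z : BoxQuot ι k q) :
    truncQ ι k q (Ideal.Quotient.mk (boxIdeal ι k q) (C c) * z) = C c * truncQ ι k q z := by
  obtain ⟨f, rfl⟩ := Ideal.Quotient.mk_surjective z
  rw [← map_mul, truncQ_mk, truncQ_mk, C_mul', C_mul', LinearMap.map_smul]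

/-- The constant coefficient of `truncQ [f]` is that of `f` (for `q ≥ 1`). [folklore] -/
theorem coeff_zero_truncQ_mk (hq : 1 ≤ q) (f : MvPolynomial ι k) :
    coeff 0 (truncQ ι k q (Ideal.Quotient.mk (boxIdeal ι k q) f)) = coeff 0 f := by
  rw [truncQ_mk, coeff_trunc, if_pos]
  intro i
  simp only [Finsupp.coe_zero, Pi.zero_apply]
  omega

end BoxIdeal

end Summit.ResolutionOfSingularities.KangarooAtlas.Mizutani
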